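import Summits.ResolutionOfSingularities.ResolutionOfSingularities.Theorems.MarkedTransferCampaignW46ThreefoldsGammaFreeGlobalLadder
import Literature.AlgebraicGeometry.Resolution.IdealisticExponentResolution
import Literature.AlgebraicGeometry.Resolution.BlowupDisjointCentreSplitting
import Literature.AlgebraicGeometry.Resolution.BlowupDisjointCentreWeights
import Literature.AlgebraicGeometry.Resolution.BlowupRestrictOpen
import Literature.AlgebraicGeometry.Resolution.BlowupsLocal
import Literature.AlgebraicGeometry.Resolution.RegularCentreBlowupOrder
import HarnessLib

/-!
# [CoP1] Prop. 4.4 (`CossartPiltant2008_prop44`, FACT-LIST F-71) in the currency of the W4.6 campaign: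
# `OrderReducible (J, μ)` on the Cossart–Piltant stages ⇒ a permissible sequence with INTEGRAL centres

[L1 W4.5a · crux `FInjectiveMacaulayfication` (stmt-ResolutionOfSingularities-15315), print input `hP` of the door closer
`OfCesnaviciusFact.fInjectiveMacaulayfication_of_localDoorAdm_of_cesnaviciusOffClosed` ⟸ `CossartPiltant2019Principalization`
⟸ `CossartPiltant2008_prop44` (`CossartPiltant2019Principalization_holds_of`, `IdealisticExponentResolution.lean`); also the binder
`hP44` of the W5.2 rung R6 (`DepthTargets.flagEngineTwo_threefold_holds`). D-0154 (2) RES inputs cell, seat res-inputs-p-8b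
("second half / assembly"). PROVED dictionary, fact-free; nothing of the manuscript under adjudication is used.]

THE POINT. The W4.6 campaign (`CampaignW46`, files `…MarkedTransferCampaignW46Threefolds*`) proves SLICES of Cossart–Piltant
2008 Prop. 4.4 for a general ideal sheaf `J` on a regular locally Noetherian scheme in its own currency
`CampaignW46.OrderReducible J m` (`…GammaFreeGlobalLadder`): "there is a SEQUENCE OF PERMISSIBLE BLOWING-UPS
(`CampaignW46.IsPermissibleBlowupSeq`: each centre a REGULAR closed subscheme — possibly reducible, possibly empty — inside the locus
`{ord ≥ m}` of the current controlled transform) whose last transform has order `< m` everywhere" — e.g.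
`orderReducible_of_finite_two_le_tau` (isolated `τ ≥ 2` points, incl. the exclusion of infinite chains of near points,
`false_of_nearChain_tau_two`), `orderReducible_of_two_le_tau_locus`, `orderReducible_of_noNearPoints` [Cossart–Piltant 2008, Lemma 4.3,
proof of Prop. 4.4 pp. 9–11]. The named fact `CossartPiltant2008_prop44` is written in the OLDER currency `IsPermissibleSeq π J μ J'`
(`PrincipalizationOfProp44.lean`): every centre an INTEGRAL regular closed subscheme inside `Σ = {ord = μ}`. This file proves that
the two currencies agree under the hypotheses of Prop. 4.4 (`X` Noetherian regular, `μ` the maximal order of `J`):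

* `isPermissibleBlowupSeq_of_isPermissibleSeq` — the easy direction;
* `IsPermissibleSeq.append_pieces` — RE-SEQUENCING: a blowing up of the last stage of a permissible sequence along a regular centre
  `C` inside `Σ`, split into its (finitely many, pairwise disjoint) irreducible components `Z₁, …, Z_k`
  (`Scheme.IsRegular.exists_pieces`), FACTORS LITERALLY as the successive blowing ups along `𝓘(Z₁)`, `𝓘(τ⁻¹Z₂)`, …
  (tree `IsBlowup.exists_comp_eq_of_isPiecePartition_cons`, Stacks 080A read backwards) — each an `IsPermissibleSeq.cons` step —
  and the one-step controlled transform is the iterated one (tree `IsBlowup.controlledTransform_comp_of_disjoint`)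
  [Bierstone–Grigoriev–Milman–Włodarczyk 2011, §4 Step 2b];
* `exists_isPermissibleSeq_iso_of_isPermissibleBlowupSeq` — induction on the W4.6 sequence, carrying an isomorphism of the last
  stages (empty centres are isomorphism steps, `IsBlowup.isIso`) and the max-order invariant `ord ≤ μ`
  (`IsBlowup.idealOrder_controlledTransform_le_of_forall`, Cossart–Piltant 2008 Prop. 4.2 (a));
* `exists_isPermissibleSeq_of_orderReducible`, `orderReducible_iff_exists_isPermissibleSeq` — THE DICTIONARY;
* `cossartPiltant2008_prop44_of_orderReducible`, `cossartPiltant2008_prop44_iff` — **F-71 ⟺ "`OrderReducible J μ` for every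
  idealistic exponent `(J, μ)` (`μ ≥ 1` the maximal order, `V(J)` of codimension `≥ 2`) on every stage of a Cossart–Piltant
  sequence over a regular excellent integral Noetherian threefold"** — so every `CampaignW46.orderReducible_*` slice is at once a
  slice of F-71, and the remaining print input of W4.5a/W5.2 is exactly the W4.6 order-reduction statement for codimension-2
  idealistic exponents on threefolds (its open part as of 2026-08-28: the `τ = 1` engine, Cossart–Piltant 2008 Lemma 4.5 /
  CJS 2020 Thm. 13.7–14.4, and the curve phase of the algorithm, steps 1–3).

HONEST STATUS. `CossartPiltant2008_prop44` itself is NOT proved here (nor is resolution in dimension `≥ 4` or in positive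
characteristic); this is bookkeeping between two kernel currencies. AI-written; AI review is weaker than expert review.

## References
* V. Cossart, O. Piltant, *Resolution of singularities of threefolds in positive characteristic I*, J. Algebra 320 (2008), Prop. 4.2 (a),
  Lemma 4.3, Prop. 4.4 (pp. 7–13). [CossartPiltant2008]
* E. Bierstone, D. Grigoriev, P. Milman, J. Włodarczyk, *Effective Hironaka resolution and its complexity*, Asian J. Math. 15 (2011),
  §4 Step 2b, Def. 3.1.3, §3.2. [BierstoneGrigorievMilmanWlodarczyk2011]
* The Stacks Project, Tag 080A, Tag 02OS, Tag 0357. [StacksProject]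
-/

-- `Summit.<Summit>.<Sub>.Theorems` with `Sub = Summit` (single-conjunct summit, D-0017)
set_option linter.dupNamespace false

noncomputable section

open CategoryTheory AlgebraicGeometry TopologicalSpace IsLocalRing
open Literature.AlgebraicGeometry.Resolution Scheme.IdealSheafData

namespace Summit.ResolutionOfSingularities.ResolutionOfSingularities.Theorems

namespace CP2008Prop44

universe u

/-! ## §1 The easy direction: integral centres in `{ord = μ}` are regular centres in `{ord ≥ μ}` -/

/-- Every permissible sequence in the sense of [CoP1] (`IsPermissibleSeq`: integral regular centres inside `{ord = μ}`) is a
sequence of permissible blowing-ups in the sense of the W4.6 campaign (`CampaignW46.IsPermissibleBlowupSeq`: regular centres inside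
`{ord ≥ μ}`), with the same stages, morphism and last transform. [cite: CossartPiltant2008, proof of Prop. 4.2] -/
theorem isPermissibleBlowupSeq_of_isPermissibleSeq :
    ∀ {X' X : Scheme.{u}} {π : X' ⟶ X} {J : X.IdealSheafData} {μ : ℕ} {J' : X'.IdealSheafData},
      IsPermissibleSeq π J μ J' → CampaignW46.IsPermissibleBlowupSeq J μ π J' := by
  intro X' X π J μ J' h
  induction h with
  | nil J μ => exact CampaignW46.IsPermissibleBlowupSeq.nil
  | cons τ π J μ J' Y _ _ hreg hY hτ ih =>
    exact ih.blowup Y τ hreg (fun y hy => (hY y hy).symm.le) hτ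

/-! ## §2 Re-sequencing one blowing up along a reducible regular centre into its irreducible components -/

/-- The induction behind `IsPermissibleSeq.append_pieces`, on the number of pieces.
[cite: BierstoneGrigorievMilmanWlodarczyk2011, §4 Step 2b] -/
private theorem append_pieces_aux {X₀ : Scheme.{u}} {J₀ : X₀.IdealSheafData} {μ : ℕ} (n : ℕ) :
    ∀ {X : Scheme.{u}} [IsLocallyNoetherian X] {σ : X ⟶ X₀} {J : X.IdealSheafData}
      (_hσ : IsPermissibleSeq σ J₀ μ J) {C : X.IdealSheafData} (_hC : Scheme.IsRegular C.subscheme)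
      {Zs : List (Closeds X)} (_hlen : Zs.length = n) (_hne : Zs ≠ []) (_hP : IsPiecePartition C Zs)
      (_hirr : ∀ Z ∈ Zs, IsIrreducible (Z : Set X))
      (_hord : ∀ y ∈ (C.support : Set X), idealOrder J y = μ)
      {X' : Scheme.{u}} {τ : X' ⟶ X} (_hτ : IsBlowup τ C),
      IsPermissibleSeq (τ ≫ σ) J₀ μ (controlledTransform τ C J μ) := by
  induction n with
  | zero =>
    intro X _ σ J _ C _ Zs hlen hne
    exact absurd (List.eq_nil_of_length_eq_zero hlen) hne
  | succ n ih =>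
    intro X _ σ J hσ C hC Zs hlen hne hP hirr hord X' τ hτ
    obtain ⟨Z, Zs', rfl⟩ : ∃ Z Zs', Zs = Z :: Zs' := by
      cases Zs with
      | nil => exact absurd rfl hne
      | cons Z Zs' => exact ⟨Z, Zs', rfl⟩
    have hlen' : Zs'.length = n := by simpa using hlen
    -- the first piece lies in `V(C)`, hence in `{ord = μ}`; it is an integral regular centre
    have hZC : (Z : Set X) ⊆ (C.support : Set X) := by
      rw [← hP.2]
      exact Set.subset_iUnion₂ (s := fun (Z' : Closeds X) (_ : Z' ∈ Z :: Zs') => (Z' : Set X)) Z List.mem_cons_self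
    have hY : ∀ y ∈ (Z : Set X), idealOrder J y = μ := fun y hy => hord y (hZC hy)
    have hint : IsIntegral (vanishingIdeal Z).subscheme :=
      isIntegral_subscheme_vanishingIdeal_piece (hirr Z List.mem_cons_self)
    have hreg : Scheme.IsRegular (vanishingIdeal Z).subscheme :=
      isRegular_subscheme_vanishingIdeal_piece hC hP List.mem_cons_self
    by_cases hnil : Zs' = []
    · -- ONE piece: `C = 𝓘(Z)` and the blowing up is a single `cons` step
      subst hnil
      have hCZ : C = vanishingIdeal Z := by
        rw [← prod_pieceIdeals_eq_of_isRegular hC hP]; simp [pieceIdeals]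
      subst hCZ
      exact IsPermissibleSeq.cons τ σ J₀ μ J Z hσ hint hreg hY hτ
    · -- SEVERAL pieces: peel the first (Stacks 080A read backwards), recurse on the pulled-back remaining pieces
      obtain ⟨X₁, τ₁, τ₂, hcomp, hτ₁, -, -, hX₁, hcomap, hτ₂, hC₁, hP₁⟩ := hτ.exists_comp_eq_of_isPiecePartition_cons hC hP
      haveI : IsLocallyNoetherian X₁ := hX₁
      haveI : IsLocallyNoetherian X' := hτ.isLocallyNoetherian
      -- the first step
      have hσ₁ : IsPermissibleSeq (τ₁ ≫ σ) J₀ μ (controlledTransform τ₁ (vanishingIdeal Z) J μ) :=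
        IsPermissibleSeq.cons τ₁ σ J₀ μ J Z hσ hint hreg hY hτ₁
      -- the remaining pieces, pulled back: irreducible, and inside `{ord = μ}` of the new transform
      have hirr₁ : ∀ Z₁ ∈ Zs'.map (fun W : Closeds X => W.preimage τ₁.continuous), IsIrreducible (Z₁ : Set X₁) := by
        intro Z₁ hZ₁
        obtain ⟨W, hW, rfl⟩ := List.mem_map.mp hZ₁
        exact IsBlowup.isIrreducible_preimage_of_isPiecePartition_cons hP hτ₁ hW (hirr W (List.mem_cons_of_mem _ hW))
      have hord₁ : ∀ y ∈ (((pieceIdeals (Zs'.map fun W : Closeds X => W.preimage τ₁.continuous)).prod).support : Set X₁),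
          idealOrder (controlledTransform τ₁ (vanishingIdeal Z) J μ) y = μ := by
        intro y hy
        rw [← hP₁.2] at hy
        simp only [List.mem_map, Set.mem_iUnion, exists_prop] at hy
        obtain ⟨_, ⟨W, hW, rfl⟩, hyW⟩ := hy
        have hyW' : τ₁ y ∈ (W : Set X) := hyW
        have hyZ : τ₁ y ∉ ((vanishingIdeal Z).support : Set X) := by
          rw [Scheme.IdealSheafData.coe_support_vanishingIdeal]
          exact Set.disjoint_right.mp (hP.disjoint_of_mem_tail hW) hyW'
        rw [hτ₁.idealOrder_controlledTransform_of_not_mem J μ hyZ]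
        refine hord _ ?_
        rw [← hP.2]
        exact Set.subset_iUnion₂ (s := fun (Z' : Closeds X) (_ : Z' ∈ Z :: Zs') => (Z' : Set X)) W
          (List.mem_cons_of_mem _ hW) hyW'
      have hne₁ : Zs'.map (fun W : Closeds X => W.preimage τ₁.continuous) ≠ [] := by simpa using hnil
      have hlen₁ : (Zs'.map (fun W : Closeds X => W.preimage τ₁.continuous)).length = n := by simpa using hlen'
      have hrec := ih hσ₁ hC₁ hlen₁ hne₁ hP₁ hirr₁ hord₁ hτ₂
      -- `C = 𝓘(Z) · Π 𝓘(W)` and the one-step controlled transform is the two-step one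
      have hCprod : C = vanishingIdeal Z * (pieceIdeals Zs').prod := by
        rw [← prod_pieceIdeals_eq_of_isRegular hC hP]; simp [pieceIdeals]
      have hdisj : Disjoint ((vanishingIdeal Z).support : Set X) (((pieceIdeals Zs').prod).support : Set X) := by
        rw [Scheme.IdealSheafData.coe_support_vanishingIdeal, ← (isPiecePartition_prod_pieceIdeals hP.pairwise_tail).2]
        exact Set.disjoint_iUnion₂_right.mpr fun W hW => hP.disjoint_of_mem_tail hW
      have hτ₂' : IsBlowup τ₂ (((pieceIdeals Zs').prod).comap τ₁) := by rw [hcomap]; exact hτ₂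
      subst hcomp
      rw [Category.assoc, hCprod, hτ₁.controlledTransform_comp_of_disjoint hτ₂' hdisj J μ, hcomap]
      exact hrec

/-- **RE-SEQUENCING A REDUCIBLE REGULAR CENTRE.** Let `σ : X → X₀` with last transform `J` be a permissible sequence for
`(J₀, μ)` in the sense of [CoP1] (`IsPermissibleSeq`), `X` locally Noetherian with Noetherian underlying space, `C` an ideal sheaf
on `X` with `V(C)` a non-empty REGULAR scheme all of whose points have `ord J = μ`, and `τ : X' → X` ANY blowing up along `C`. Then
`τ ≫ σ` with the controlled transform `τᶜ(J, μ)` is again a permissible sequence for `(J₀, μ)`: `τ` factors literally as the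
successive blowing ups along the (integral, regular) irreducible components of `V(C)`, pulled back one after the other, and the
controlled transforms compose. [cite: BierstoneGrigorievMilmanWlodarczyk2011, §4 Step 2b] [cite: StacksProject, Tag 080A] -/
theorem IsPermissibleSeq.append_pieces {X₀ X : Scheme.{u}} [IsLocallyNoetherian X] [NoetherianSpace X] {σ : X ⟶ X₀}
    {J₀ : X₀.IdealSheafData} {μ : ℕ} {J : X.IdealSheafData} (hσ : IsPermissibleSeq σ J₀ μ J)
    {C : X.IdealSheafData} (hC : Scheme.IsRegular C.subscheme) (hCtop : C ≠ ⊤)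
    (hord : ∀ y ∈ (C.support : Set X), idealOrder J y = μ) {X' : Scheme.{u}} {τ : X' ⟶ X} (hτ : IsBlowup τ C) :
    IsPermissibleSeq (τ ≫ σ) J₀ μ (controlledTransform τ C J μ) := by
  obtain ⟨Zs, hP, -, hirr, hprod, -⟩ := Scheme.IsRegular.exists_pieces hC
  have hne : Zs ≠ [] := by
    rintro rfl
    apply hCtop
    rw [← hprod]
    simp [pieceIdeals]
  exact append_pieces_aux Zs.length hσ hC rfl hne hP hirr hord hτ

/-! ## §3 From a W4.6 sequence to a [CoP1] sequence with isomorphic last stage -/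

/-- Inserting an isomorphism of the base between a morphism and its centre/ideal does not change the controlled transform.
[folklore] -/
theorem controlledTransform_comp_iso_inv {X'' X' Z : Scheme.{u}} (π : Z ⟶ X') (e : X'' ≅ X')
    (C J : X'.IdealSheafData) (μ : ℕ) :
    controlledTransform (π ≫ e.inv) (C.comap e.hom) (J.comap e.hom) μ = controlledTransform π C J μ := by
  simp only [controlledTransform, ← Scheme.IdealSheafData.comap_comp, Category.assoc, Iso.inv_hom_id,
    Category.comp_id]

/-- A Noetherian scheme stays Noetherian after a blowing up. [cite: StacksProject, Tag 02NS] -/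
theorem isNoetherian_of_isBlowup {X' X : Scheme.{u}} [IsNoetherian X] {π : X' ⟶ X} {C : X.IdealSheafData}
    (hπ : IsBlowup π C) : IsNoetherian X' := by
  haveI : IsProper π := hπ.isProper
  haveI := LocallyOfFiniteType.isLocallyNoetherian π
  haveI := QuasiCompact.compactSpace_of_compactSpace π
  exact {}

/-- **Every sequence of permissible blowing-ups of the W4.6 campaign is, up to an isomorphism of the last stage, a permissible
sequence of [CoP1]** — for `X` Noetherian and regular and `μ` an upper bound for the order of `J` (so that `{ord ≥ μ} = {ord = μ}`
at every stage, Cossart–Piltant 2008 Prop. 4.2 (a)): there are a [CoP1] permissible sequence `π : X'' → X` with last transform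
`J''` and an isomorphism `e : X'' ≅ X₁` over `X` with `J'' = e^* J₁`; moreover `ord J₁ ≤ μ` everywhere.
[cite: CossartPiltant2008, proof of Prop. 4.2 (a)] [cite: BierstoneGrigorievMilmanWlodarczyk2011, §4 Step 2b] -/
theorem exists_isPermissibleSeq_iso_of_isPermissibleBlowupSeq {X : Scheme.{u}} [IsNoetherian X] (hX : Scheme.IsRegular X)
    {J : X.IdealSheafData} {μ : ℕ} (hle : ∀ x, idealOrder J x ≤ μ) :
    ∀ {X₁ : Scheme.{u}} {Φ : X₁ ⟶ X} {J₁ : X₁.IdealSheafData}, CampaignW46.IsPermissibleBlowupSeq J μ Φ J₁ →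
      (∀ x, idealOrder J₁ x ≤ μ) ∧
      ∃ (X'' : Scheme.{u}) (_ : IsNoetherian X'') (π : X'' ⟶ X) (J'' : X''.IdealSheafData) (e : X'' ≅ X₁),
        IsPermissibleSeq π J μ J'' ∧ e.hom ≫ Φ = π ∧ J'' = J₁.comap e.hom := by
  intro X₁ Φ J₁ h
  induction h with
  | nil =>
    exact ⟨hle, X, inferInstance, 𝟙 X, J, Iso.refl X, IsPermissibleSeq.nil J μ, by simp, by simp⟩
  | @blowup Z'' Z' σ J' h D π hreg hD hπ ih =>
    obtain ⟨hle', X'', hX''N, πc, J'', e, hseq, he, hJ⟩ := ih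
    haveI := hX''N
    have hZ' := h.isLocallyNoetherian_and_isRegular inferInstance hX
    haveI : IsLocallyNoetherian Z' := hZ'.1
    haveI : IsLocallyNoetherian Z'' := hπ.isLocallyNoetherian
    -- the centre lies in `{ord = μ}`; the max-order invariant persists
    have hY : ∀ y ∈ (D : Set Z'), idealOrder J' y = μ := fun y hy => le_antisymm (hle' y) (hD y hy)
    have hle₂ : ∀ x, idealOrder (controlledTransform π (vanishingIdeal D) J' μ) x ≤ μ :=
      hπ.idealOrder_controlledTransform_le_of_forall hZ'.2 hreg hY hle'
    refine ⟨hle₂, ?_⟩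
    -- move the centre and the blowing up along `e : X'' ≅ Z'`
    set C'' : X''.IdealSheafData := (vanishingIdeal D).comap e.hom with hC''def
    have hC'' : Scheme.IsRegular C''.subscheme := Scheme.IsRegular.subscheme_comap_of_isOpenImmersion e.hom hreg
    have hπ'' : IsBlowup (π ≫ e.inv) C'' := hπ.comp_iso e.symm
    have hordC'' : ∀ y ∈ (C''.support : Set X''), idealOrder J'' y = μ := by
      intro y hy
      rw [hC''def, mem_support_comap_iff, Scheme.IdealSheafData.coe_support_vanishingIdeal] at hy
      rw [hJ, idealOrder_comap_of_isOpenImmersion]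
      exact hY _ hy
    by_cases htop : C'' = ⊤
    · -- EMPTY centre: the blowing up is an isomorphism, absorbed into `e`
      have hiso : IsIso (π ≫ e.inv) := by
        rw [htop] at hπ''
        exact hπ''.isIso isEffectiveCartier_top
      let ε : Z'' ≅ X'' := asIso (π ≫ e.inv)
      have hεπ : ε.inv ≫ π = e.hom := by
        rw [← cancel_mono e.inv, Category.assoc]
        exact ε.inv_hom_id.trans e.hom_inv_id.symm
      have hCπ : (vanishingIdeal D).comap π = ⊤ := by
        have : π = (π ≫ e.inv) ≫ e.hom := by simp
        rw [this, Scheme.IdealSheafData.comap_comp]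
        change C''.comap (π ≫ e.inv) = ⊤
        rw [htop, Scheme.IdealSheafData.comap_top]
      have hct : controlledTransform π (vanishingIdeal D) J' μ = J'.comap π := by
        rw [controlledTransform, hCπ, ← Scheme.IdealSheafData.one_eq_top, one_pow, Scheme.IdealSheafData.one_eq_top, colon_top]
      refine ⟨X'', hX''N, πc, J'', ε.symm, hseq, ?_, ?_⟩
      · rw [Iso.symm_hom, ← Category.assoc, hεπ, he]
      · rw [hct, Iso.symm_hom, ← Scheme.IdealSheafData.comap_comp, hεπ, hJ]
    · -- NON-EMPTY centre: re-sequence along the irreducible components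
      have hA := IsPermissibleSeq.append_pieces hseq hC'' htop hordC'' hπ''
      haveI : IsNoetherian Z'' := isNoetherian_of_isBlowup hπ''
      refine ⟨Z'', inferInstance, (π ≫ e.inv) ≫ πc, controlledTransform (π ≫ e.inv) C'' J'' μ, Iso.refl Z'', hA, ?_, ?_⟩
      · rw [← he]; simp
      · rw [Iso.refl_hom, Scheme.IdealSheafData.comap_id, hC''def, hJ, controlledTransform_comp_iso_inv]

/-! ## §4 The dictionary -/

/-- **THE DICTIONARY, hard direction.** `X` Noetherian regular, `J` an ideal sheaf with `ord_x J ≤ μ` everywhere: if `(X, J, μ)` is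
order-reducible by permissible blowing-ups in the sense of the W4.6 campaign (`CampaignW46.OrderReducible J μ`), then there is a
permissible sequence `π : X' → X` for `(J, μ)` in the sense of [CoP1] (INTEGRAL regular centres inside `{ord = μ}`, weak
transforms) whose last transform has `ord < μ` everywhere — the conclusion of Cossart–Piltant 2008 Prop. 4.4.
[cite: CossartPiltant2008, Prop. 4.4] [cite: BierstoneGrigorievMilmanWlodarczyk2011, §4 Step 2b] -/
theorem exists_isPermissibleSeq_of_orderReducible {X : Scheme.{u}} [IsNoetherian X] (hX : Scheme.IsRegular X)
    {J : X.IdealSheafData} {μ : ℕ} (hle : ∀ x, idealOrder J x ≤ μ) (h : CampaignW46.OrderReducible J μ) :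
    ∃ (X' : Scheme.{u}) (π : X' ⟶ X) (J' : X'.IdealSheafData), IsPermissibleSeq π J μ J' ∧ ∀ x, idealOrder J' x < μ := by
  obtain ⟨X₁, Φ, J₁, hseq, hlt⟩ := h
  obtain ⟨-, X'', -, π, J'', e, hπ, -, hJ⟩ := exists_isPermissibleSeq_iso_of_isPermissibleBlowupSeq hX hle hseq
  refine ⟨X'', π, J'', hπ, fun x => ?_⟩
  rw [hJ, idealOrder_comap_of_isOpenImmersion]
  exact hlt _

/-- **THE DICTIONARY.** For `X` Noetherian regular and `ord J ≤ μ` everywhere: `CampaignW46.OrderReducible J μ` iff the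
conclusion of Cossart–Piltant 2008 Prop. 4.4 holds for `(J, μ)` in the currency `IsPermissibleSeq`.
[cite: CossartPiltant2008, Prop. 4.4] -/
theorem orderReducible_iff_exists_isPermissibleSeq {X : Scheme.{u}} [IsNoetherian X] (hX : Scheme.IsRegular X)
    {J : X.IdealSheafData} {μ : ℕ} (hle : ∀ x, idealOrder J x ≤ μ) :
    CampaignW46.OrderReducible J μ ↔
      ∃ (X' : Scheme.{u}) (π : X' ⟶ X) (J' : X'.IdealSheafData), IsPermissibleSeq π J μ J' ∧ ∀ x, idealOrder J' x < μ := by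
  refine ⟨exists_isPermissibleSeq_of_orderReducible hX hle, ?_⟩
  rintro ⟨X', π, J', hπ, hlt⟩
  exact ⟨X', π, J', isPermissibleBlowupSeq_of_isPermissibleSeq hπ, hlt⟩

/-! ## §5 F-71 in the W4.6 currency -/

/-- **[CoP1] Prop. 4.4 (FACT-LIST F-71) FROM ORDER-REDUCIBILITY ON THE COSSART–PILTANT STAGES.** If for every regular excellent
integral Noetherian threefold `S`, every `I ≠ 0`, every stage `ρ : X → S` of a Cossart–Piltant sequence for `I`
(`IsRegularCentreBlowupSeq ρ I`, `X` integral Noetherian) and every idealistic exponent `(J, μ)` on `X` with `μ ≥ 1` the maximal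
order of `J` and `V(J)` of codimension `≥ 2`, the input `(X, J, μ)` is order-reducible in the sense of the W4.6 campaign, then
`CossartPiltant2008_prop44` holds (stages of Cossart–Piltant sequences over regular `S` are regular, `IsRegularCentreBlowupSeq.isRegular`,
Liu Thm. 8.1.19). [cite: CossartPiltant2008, Prop. 4.4] [cite: Liu2002, Thm. 8.1.19 (a)] -/
theorem cossartPiltant2008_prop44_of_orderReducible
    (h : ∀ (S : Scheme.{u}) [IsIntegral S] [IsNoetherian S], Scheme.IsRegular S → Scheme.IsExcellent S →
      topologicalKrullDim S = 3 → ∀ (I : S.IdealSheafData), I ≠ ⊥ →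
      ∀ (X : Scheme.{u}) (ρ : X ⟶ S) [IsIntegral X] [IsNoetherian X], IsRegularCentreBlowupSeq ρ I →
        ∀ (J : X.IdealSheafData) (μ : ℕ), 1 ≤ μ → (∀ x ∈ J.support, 1 < Order.coheight x) →
        (∀ x, idealOrder J x ≤ μ) → (∃ x, idealOrder J x = μ) → CampaignW46.OrderReducible J μ) :
    CossartPiltant2008_prop44.{u} := by
  intro S _ _ hS hexc hdim I hI X ρ _ _ hρ J μ hμ hcodim hle hmax
  exact exists_isPermissibleSeq_of_orderReducible (hρ.isRegular hS) hle (h S hS hexc hdim I hI X ρ hρ J μ hμ hcodim hle hmax)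

/-- The converse: Prop. 4.4 gives order-reducibility on the stages (easy direction of the dictionary). [cite: CossartPiltant2008, Prop. 4.4] -/
theorem orderReducible_of_cossartPiltant2008_prop44 (h44 : CossartPiltant2008_prop44.{u})
    (S : Scheme.{u}) [IsIntegral S] [IsNoetherian S] (hS : Scheme.IsRegular S) (hexc : Scheme.IsExcellent S)
    (hdim : topologicalKrullDim S = 3) (I : S.IdealSheafData) (hI : I ≠ ⊥)
    (X : Scheme.{u}) (ρ : X ⟶ S) [IsIntegral X] [IsNoetherian X] (hρ : IsRegularCentreBlowupSeq ρ I)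
    (J : X.IdealSheafData) (μ : ℕ) (hμ : 1 ≤ μ) (hcodim : ∀ x ∈ J.support, 1 < Order.coheight x)
    (hle : ∀ x, idealOrder J x ≤ μ) (hmax : ∃ x, idealOrder J x = μ) : CampaignW46.OrderReducible J μ := by
  obtain ⟨X', π, J', hπ, hlt⟩ := h44 S hS hexc hdim I hI X ρ hρ J μ hμ hcodim hle hmax
  exact ⟨X', π, J', isPermissibleBlowupSeq_of_isPermissibleSeq hπ, hlt⟩

/-- **F-71 ⟺ ORDER-REDUCIBILITY OF CODIMENSION-2 IDEALISTIC EXPONENTS ON THE COSSART–PILTANT STAGES** (the named fact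
`CossartPiltant2008_prop44` read in the currency of the W4.6 campaign, binders verbatim). [cite: CossartPiltant2008, Prop. 4.4] -/
theorem cossartPiltant2008_prop44_iff :
    CossartPiltant2008_prop44.{u} ↔
      ∀ (S : Scheme.{u}) [IsIntegral S] [IsNoetherian S], Scheme.IsRegular S → Scheme.IsExcellent S →
        topologicalKrullDim S = 3 → ∀ (I : S.IdealSheafData), I ≠ ⊥ →
        ∀ (X : Scheme.{u}) (ρ : X ⟶ S) [IsIntegral X] [IsNoetherian X], IsRegularCentreBlowupSeq ρ I →
          ∀ (J : X.IdealSheafData) (μ : ℕ), 1 ≤ μ → (∀ x ∈ J.support, 1 < Order.coheight x) →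
          (∀ x, idealOrder J x ≤ μ) → (∃ x, idealOrder J x = μ) → CampaignW46.OrderReducible J μ :=
  ⟨fun h44 S _ _ hS hexc hdim I hI X ρ _ _ hρ J μ hμ hcodim hle hmax =>
      orderReducible_of_cossartPiltant2008_prop44 h44 S hS hexc hdim I hI X ρ hρ J μ hμ hcodim hle hmax,
    cossartPiltant2008_prop44_of_orderReducible⟩

end CP2008Prop44

end Summit.ResolutionOfSingularities.ResolutionOfSingularities.Theorems

end
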